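import Literature.Analysis.FluidPDE.HardSphereFlowRestart
import Literature.Analysis.FluidPDE.HardSphereTorusMeasure
import HarnessLib

/-!
# Transfer of the hard-sphere flow between `ℝ^d` and the flat torus: definitions

Definitions for the proof of **Alexander's theorem in `ℝ^d`**
(`Literature.Analysis.FluidPDE.HardSphereFlow.nonempty`, discharged in
`Literature.Analysis.FluidPDE.HardSphereEuclideanAlexander` by *transfer* from the torus theorem
of `HardSphereAlexander` through the map `z ↦ P (L⁻¹ z)` — rescale, then project positions to
`T^d`; Gallagher–Saint-Raymond–Texier 2013 Prop. 4.1.1 is stated in `ℝ^{2dN}`,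
Cercignani–Illner–Pulvirenti 1994 App. 4.A p. 111 treats `Λ = ℝ³` "similarly" to the torus).
This file only introduces the objects; their theory is `HardSphereEuclideanTransfer` and
`HardSphereEuclideanAlexander`.

* `Alexander.projConfig z` — the projection of a configuration of `(ℝ^d × ℝ^d)^N` to
  `(T^d × ℝ^d)^N`: positions modulo `ℤ^d` (`Torus.proj`), velocities kept.
* `Alexander.reprConfig w` — the lift back: positions replaced by their symmetric representatives
  `Torus.reprSym` in `(-1/2, 1/2]^d`.
* `Alexander.chartCube N d` — the configurations of `ℝ^d` with all positions in `(-1/2, 1/2]^d`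
  (`Torus.symCube`), the measurable fundamental domain on which `projConfig` is injective with
  inverse `reprConfig`.
* `Alexander.phaseBox N d R` — the box `{‖x_i‖ ≤ R, ‖v_i‖ ≤ R}` used to exhaust the phase space.
* `Alexander.IsChartSafe T z` — *chart-safe data for the horizon `T`*: positions bounded by `ρ`,
  energy by `V²/2`, with `ρ + (T + 1) V < 1/4`, so that within time `T + 1` all particles stay in
  the ball of radius `1/4` where the projection is a chart of the torus geometry.
* `Alexander.goodUpTo G ε T` — the *truncated good set*: domain, time-`0` conventions of
  `Alexander.good`, and truncated forward regularity `FwdGoodUpTo T` (`HardSphereFlowRestart`) of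
  the datum and of its velocity flip; `good = ⋂ₙ goodUpTo n` (`good_eq_iInter_goodUpTo`).

## Mathlib / Literature reuse

`Torus.proj` (`FunctionSpaces.FlatTorus`), `Torus.reprSym` (`HardSpherePhaseSpace`),
`Torus.symCube` (`HardSphereTorusMeasure`), `Alexander.good`, `FwdGood`
(`HardSphereFlowConstruction`), `FwdGoodUpTo`, `fwdGood_iff_forall_fwdGoodUpTo`
(`HardSphereFlowRestart`). Nothing here has a Mathlib counterpart.

## References

* I. Gallagher, L. Saint-Raymond, B. Texier, *From Newton to Boltzmann: hard spheres and
  short-range potentials*, EMS (2013), arXiv:1208.5753, Prop. 4.1.1 and its proof (p. 19).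
* C. Cercignani, R. Illner, M. Pulvirenti, *The Mathematical Theory of Dilute Gases*, Springer
  (1994), Thm. 4.2.1, App. 4.A pp. 107–111.
-/

open Set Filter Topology Function MeasureTheory
open scoped ENNReal

namespace Literature.Analysis.FluidPDE

noncomputable section

section Kinetic

variable {d : Type*} [Fintype d] {N : ℕ}

namespace Alexander

/-! ## Projection and lift -/

/-- The projection of an `N`-particle configuration of `ℝ^d` to the flat torus: positions are
taken modulo `ℤ^d` (`Torus.proj`), velocities are kept (GST 2013 Ch. 4 intro: hard spheres on
`T^d` are hard spheres on `ℝ^d` modulo the lattice). [folklore] -/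
def projConfig (z : Config N d (EuclideanSpace ℝ d)) : Config N d (UnitAddTorus d) :=
  fun i => (FunctionSpaces.Torus.proj (z i).1, (z i).2)

omit [Fintype d] in
/-- Positions of the projected configuration. [folklore] -/
@[simp]
theorem projConfig_apply_fst (z : Config N d (EuclideanSpace ℝ d)) (i : Fin N) :
    (projConfig z i).1 = FunctionSpaces.Torus.proj (z i).1 := rfl

omit [Fintype d] in
/-- Velocities of the projected configuration. [folklore] -/
@[simp]
theorem projConfig_apply_snd (z : Config N d (EuclideanSpace ℝ d)) (i : Fin N) :
    (projConfig z i).2 = (z i).2 := rfl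

/-- The lift of a torus configuration to `ℝ^d`: positions are replaced by their symmetric
representatives in `(-1/2, 1/2]^d` (`Torus.reprSym`), velocities are kept. [folklore] -/
def reprConfig (w : Config N d (UnitAddTorus d)) : Config N d (EuclideanSpace ℝ d) :=
  fun i => (Torus.reprSym (w i).1, (w i).2)

omit [Fintype d] in
/-- The lift is a section of the projection: `projConfig (reprConfig w) = w`. [folklore] -/
@[simp]
theorem projConfig_reprConfig (w : Config N d (UnitAddTorus d)) : projConfig (reprConfig w) = w := by
  funext i
  simp only [projConfig, reprConfig, Torus.proj_reprSym]

/-- The *chart cube*: configurations of `ℝ^d` all of whose positions lie in the half-open cube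
`(-1/2, 1/2]^d`, a measurable fundamental domain of `projConfig`. [folklore] -/
def chartCube (N : ℕ) (d : Type*) [Fintype d] : Set (Config N d (EuclideanSpace ℝ d)) :=
  {z | ∀ i, (z i).1 ∈ Torus.symCube d}

/-- The chart cube is a box. [folklore] -/
theorem chartCube_eq_pi :
    chartCube N d = Set.pi univ fun _ : Fin N => Torus.symCube d ×ˢ (univ : Set (EuclideanSpace ℝ d)) := by
  ext z; simp [chartCube]

/-- The chart cube is measurable. [folklore] -/
theorem measurableSet_chartCube : MeasurableSet (chartCube N d) := by
  rw [chartCube_eq_pi]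
  exact MeasurableSet.univ_pi fun _ => Torus.measurableSet_symCube.prod MeasurableSet.univ

/-- Lifted configurations lie in the chart cube. [folklore] -/
theorem reprConfig_mem_chartCube (w : Config N d (UnitAddTorus d)) : reprConfig w ∈ chartCube N d :=
  fun i => Torus.reprSym_mem_symCube (w i).1

/-- The box `{‖x_i‖ ≤ R, ‖v_i‖ ≤ R}` of the Euclidean phase space (GST 2013, proof of
Prop. 4.1.1: `B_R^N × B_R^N`). [cite: GST2013, proof of Prop. 4.1.1 p. 19] -/
def phaseBox (N : ℕ) (d : Type*) [Fintype d] (R : ℝ) : Set (Config N d (EuclideanSpace ℝ d)) :=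
  {z | ∀ i, ‖(z i).1‖ ≤ R ∧ ‖(z i).2‖ ≤ R}

/-- Membership in the box. [folklore] -/
theorem mem_phaseBox {R : ℝ} {z : Config N d (EuclideanSpace ℝ d)} :
    z ∈ phaseBox N d R ↔ ∀ i, ‖(z i).1‖ ≤ R ∧ ‖(z i).2‖ ≤ R :=
  Iff.rfl

/-! ## Chart-safe data -/

/-- `z` is *chart-safe for the horizon `T`*: its positions are bounded by some `ρ` and its
kinetic energy by `V²/2` with `ρ + (T + 1) V < 1/4`, so that every configuration reachable from
`z` within time `T + 1` by free flights and elastic collisions (speeds stay `≤ V`) has all its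
positions in the ball of radius `1/4`, where the projection to the torus is a chart. [folklore] -/
def IsChartSafe (T : ℝ) (z : Config N d (EuclideanSpace ℝ d)) : Prop :=
  ∃ ρ V : ℝ, 0 ≤ V ∧ (∀ i, ‖(z i).1‖ ≤ ρ) ∧ configEnergy z ≤ V ^ 2 / 2 ∧ ρ + (T + 1) * V < 4⁻¹

/-- Chart-safety is symmetric under the velocity flip. [folklore] -/
theorem IsChartSafe.flipVel {T : ℝ} {z : Config N d (EuclideanSpace ℝ d)} (hz : IsChartSafe T z) :
    IsChartSafe T (FluidPDE.flipVel z) := by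
  obtain ⟨ρ, V, hV, hρ, hE, hch⟩ := hz
  exact ⟨ρ, V, hV, fun i => hρ i, by rwa [configEnergy_flipVel], hch⟩

/-- A chart-safe configuration lies in the chart (`T ≥ 0`). [folklore] -/
theorem IsChartSafe.norm_fst_lt {T : ℝ} {z : Config N d (EuclideanSpace ℝ d)} (hz : IsChartSafe T z)
    (hT : 0 ≤ T) (i : Fin N) : ‖(z i).1‖ < 4⁻¹ := by
  obtain ⟨ρ, V, hV, hρ, -, hch⟩ := hz
  have : 0 ≤ (T + 1) * V := by positivity
  linarith [hρ i]

/-! ## The truncated good set -/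

variable {X : Type*} {G : Geometry d X} {ε : ℝ}

variable (G ε) in
/-- The **truncated good set** `Γ₀(T)`: the datum lies in the domain, satisfies the time-`0`
conventions of `good` (contact pairs outgoing, at most one unordered contact pair), and both it
and its velocity flip are forward regular up to time `T` (`FwdGoodUpTo`, the time-`T` truncation
of GST's "no pathological trajectory"). [cite: GST2013, Prop. 4.1.1 p. 19] -/
def goodUpTo (T : ℝ) : Set (Config N d X) :=
  {z | z ∈ hardSphereDomain G N ε ∧
    (∀ i j : Fin N, i ≠ j → z ∈ contactSet G N ε i j →
      IsOutgoing G z i j ∧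
        ∀ i' j' : Fin N, i' ≠ j' → z ∈ contactSet G N ε i' j' →
          ({i', j'} : Finset (Fin N)) = {i, j}) ∧
    FwdGoodUpTo G ε T z ∧ FwdGoodUpTo G ε T (flipVel z)}

/-- The good set lies in every truncated good set. [folklore] -/
theorem good_subset_goodUpTo (T : ℝ) : good (N := N) G ε ⊆ goodUpTo G ε T := by
  rintro z ⟨hD, hconv, hf, hb⟩
  obtain ⟨n, hn⟩ := exists_nat_ge T
  exact ⟨hD, hconv, ((fwdGood_iff_forall_fwdGoodUpTo.1 hf) n).mono hn,
    ((fwdGood_iff_forall_fwdGoodUpTo.1 hb) n).mono hn⟩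

/-- **The good set is the intersection of the truncated good sets at integer horizons.** [folklore] -/
theorem good_eq_iInter_goodUpTo : good (N := N) G ε = ⋂ n : ℕ, goodUpTo G ε (n : ℝ) := by
  ext z
  simp only [mem_iInter]
  constructor
  · exact fun hz n => good_subset_goodUpTo _ hz
  · intro h
    exact ⟨(h 0).1, (h 0).2.1, fwdGood_iff_forall_fwdGoodUpTo.2 fun n => (h n).2.2.1,
      fwdGood_iff_forall_fwdGoodUpTo.2 fun n => (h n).2.2.2⟩

end Alexander

end Kinetic

end

end Literature.Analysis.FluidPDE
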